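import Literature.Computability.Complexity.ExtMonotoneCircuits
import Literature.Computability.Complexity.ExtMonotoneGRankSupport
import Literature.Computability.Complexity.MonotoneSwitching
import Literature.Computability.Complexity.CliqueTestGraphs
import Literature.Computability.Complexity.CliqueCounting
import Literature.Computability.Complexity.ExtMonotoneCliqueGate
import Literature.Computability.Complexity.Rossman2008CliqueProofs
import Mathlib

/-!
# Stub `stub_referee` of line `width-threshold-certificate-sparsity`
(crux `CliqueExtLowerBound`, stmt-PneNP-10682)

REFEREE: first-moment nondegeneracy of the pair (bare ⌈m^{1/4}⌉-cliques vs complements of the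
t-edge graphs, t = #E/⌊m^{1/8}⌋).

POSITIVES `posGraphs m k` (clique vectors of the `k`-subsets, `k = ⌈m^{1/4}⌉₊`), NEGATIVES the
vectors `x_M e := [e ∉ M]` for the `t`-subsets `M` of the `N = C(m,2)` edge slots of `K_m`,
`t = N / ⌊m^{1/8}⌋₊`.

* §1 counting: the negatives are `C(N,t)` many (`card_neg_eq`), those containing a `k`-clique at
  most `C(m,k) · C(N - C(k,2), t)` (`card_negClique_le`, union bound over the `k`-sets); the
  positives are `C(m,k)` many (`card_posGraphs`), those meeting a set `q` of edges at most
  `#q · C(m-2,k-2)` (`card_posMeet_le`).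
* §2 numerics: `4 C(m,k) C(N - C(k,2), t) ≤ C(N,t)` eventually (`neg_numerics`:
  `(1 - L/N)^t ≤ exp(-tL/N)` and `tL/N ≳ m^{3/8}/2 ≫ (m^{1/4}+1) ln m`), and
  `4 s C(m-2,k-2) ≤ C(m,k)` once `k ≥ 2s+3` (`pos_numerics`, via `choose_sub_mul_pow_le`).
* §3 the registered stub `stub_referee` (`|E(K_m)| = C(m,2)` is `card_edgeSet_top_fin` of
  `Rossman2008CliqueProofs.lean`).
-/

set_option linter.dupNamespace false

open Literature.Computability.Complexity Filter Finset

namespace Summit.PneNP.PneNP.Theorems.CliqueExtLowerBound.WidthThreshold.Referee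

/-! ## §1 Counting -/

/-- The negative vectors `M ↦ (e ↦ [e ∉ M])` are injective in `M`. [folklore] -/
theorem negVec_injective (m : ℕ) :
    Function.Injective (fun M : Finset ((⊤ : SimpleGraph (Fin m)).edgeSet) =>
      fun e : (⊤ : SimpleGraph (Fin m)).edgeSet => decide (e ∉ M)) := by
  intro M M' h
  ext e
  have he := congrFun h e
  simp only [decide_eq_decide] at he
  tauto

/-- A `k`-set of vertices spans at least `k.choose 2` edges of `K_m`. [folklore] -/
theorem choose_two_le_card_edgesIn {m : ℕ} (K : Finset (Fin m)) :
    (#K).choose 2 ≤ #((univ : Finset ((⊤ : SimpleGraph (Fin m)).edgeSet)).filter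
      fun e : (⊤ : SimpleGraph (Fin m)).edgeSet => ∀ y ∈ (e : Sym2 (Fin m)), y ∈ K) := by
  rw [← Sym2.card_image_offDiag]
  refine Finset.card_le_card_of_surjOn Subtype.val fun z hz => ?_
  simp only [Finset.coe_image, Finset.coe_offDiag, Set.mem_image, Set.mem_offDiag,
    Finset.mem_coe, Function.uncurry, Prod.exists] at hz
  obtain ⟨a, b, ⟨ha, hb, hab⟩, rfl⟩ := hz
  have he : s(a, b) ∈ (⊤ : SimpleGraph (Fin m)).edgeSet := by
    rw [SimpleGraph.mem_edgeSet]; exact hab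
  refine ⟨⟨s(a, b), he⟩, ?_, rfl⟩
  simp only [Finset.coe_filter, Finset.mem_univ, true_and, Set.mem_setOf_eq]
  intro y hy
  rcases Sym2.mem_iff.1 hy with rfl | rfl
  · exact ha
  · exact hb

/-- **Union bound for the negatives**: the complements of the `t`-edge graphs containing a
`k`-clique number at most `C(m,k) · C(#E - C(k,2), t)`. [folklore] -/
theorem card_negClique_le (m k t : ℕ) :
    #(((powersetCard t (univ : Finset ((⊤ : SimpleGraph (Fin m)).edgeSet))).image
        (fun M => fun e : (⊤ : SimpleGraph (Fin m)).edgeSet => decide (e ∉ M))).filter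
        (fun x => cliqueFn m k x = true)) ≤
      m.choose k * (Fintype.card ((⊤ : SimpleGraph (Fin m)).edgeSet) - k.choose 2).choose t := by
  set EK : Finset (Fin m) → Finset ((⊤ : SimpleGraph (Fin m)).edgeSet) := fun K =>
    univ.filter fun e : (⊤ : SimpleGraph (Fin m)).edgeSet => ∀ y ∈ (e : Sym2 (Fin m)), y ∈ K
  calc #(((powersetCard t (univ : Finset ((⊤ : SimpleGraph (Fin m)).edgeSet))).image
        (fun M => fun e : (⊤ : SimpleGraph (Fin m)).edgeSet => decide (e ∉ M))).filter
        (fun x => cliqueFn m k x = true))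
      ≤ #((powersetCard t (univ : Finset ((⊤ : SimpleGraph (Fin m)).edgeSet))).filter
          fun M => cliqueFn m k
            (fun e : (⊤ : SimpleGraph (Fin m)).edgeSet => decide (e ∉ M)) = true) := by
        rw [Finset.filter_image]; exact Finset.card_image_le
    _ ≤ #((powersetCard k (univ : Finset (Fin m))).biUnion
          fun K => powersetCard t (univ \ EK K)) := by
        refine Finset.card_le_card fun M hM => ?_
        rw [Finset.mem_filter, Finset.mem_powersetCard,
          CliqueLPGate.cliqueFn_eq_true_iff_exists] at hM
        obtain ⟨⟨-, hMt⟩, K, hK, hKM⟩ := hM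
        refine Finset.mem_biUnion.2 ⟨K, Finset.mem_powersetCard.2 ⟨Finset.subset_univ _, hK⟩,
          Finset.mem_powersetCard.2 ⟨fun e he => ?_, hMt⟩⟩
        rw [Finset.mem_sdiff]
        refine ⟨Finset.mem_univ _, fun heK => ?_⟩
        have h1 := hKM e (Finset.mem_filter.1 heK).2
        rw [decide_eq_true_eq] at h1
        exact h1 he
    _ ≤ ∑ K ∈ powersetCard k (univ : Finset (Fin m)), #(powersetCard t (univ \ EK K)) :=
        Finset.card_biUnion_le
    _ ≤ ∑ K ∈ powersetCard k (univ : Finset (Fin m)),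
          (Fintype.card ((⊤ : SimpleGraph (Fin m)).edgeSet) - k.choose 2).choose t := by
        refine Finset.sum_le_sum fun K hK => ?_
        rw [Finset.card_powersetCard, Finset.card_univ_sdiff]
        refine Nat.choose_le_choose t (Nat.sub_le_sub_left ?_ _)
        rw [← (Finset.mem_powersetCard.1 hK).2]
        exact choose_two_le_card_edgesIn K
    _ = m.choose k *
          (Fintype.card ((⊤ : SimpleGraph (Fin m)).edgeSet) - k.choose 2).choose t := by
        rw [Finset.sum_const, Finset.card_powersetCard, Finset.card_univ, Fintype.card_fin,
          smul_eq_mul]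

/-- There are `C(#E, t)` negatives. [folklore] -/
theorem card_neg_eq (m t : ℕ) :
    #((powersetCard t (univ : Finset ((⊤ : SimpleGraph (Fin m)).edgeSet))).image
        (fun M => fun e : (⊤ : SimpleGraph (Fin m)).edgeSet => decide (e ∉ M))) =
      (Fintype.card ((⊤ : SimpleGraph (Fin m)).edgeSet)).choose t := by
  rw [Finset.card_image_of_injective _ (negVec_injective m), Finset.card_powersetCard,
    Finset.card_univ]

/-- Two `k`-sets, `k ≥ 2`, with the same clique vector are equal; so there are `C(m,k)` positive
graphs. [folklore] -/
theorem card_posGraphs {m k : ℕ} (hk : 2 ≤ k) : #(posGraphs m k) = m.choose k := by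
  unfold posGraphs
  rw [Finset.card_image_of_injOn, Finset.card_powersetCard, Finset.card_univ, Fintype.card_fin]
  intro T hT T' hT' h
  rw [Finset.mem_coe, Finset.mem_powersetCard] at hT hT'
  -- adapted from `eq_of_edges_subset` (Cruxes/CliqueExtLowerBound/Disproof.lean)
  symm
  refine Finset.eq_of_subset_of_card_le (fun v hv => ?_) (by rw [hT.2, hT'.2])
  obtain ⟨w, hw, hwv⟩ : ∃ w ∈ T', w ≠ v := by
    by_contra hno
    push Not at hno
    have h1 : T' ⊆ {v} := fun w hw => Finset.mem_singleton.2 (hno w hw)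
    have h2 := Finset.card_le_card h1
    rw [hT'.2, Finset.card_singleton] at h2
    omega
  have he : s(v, w) ∈ (⊤ : SimpleGraph (Fin m)).edgeSet := by
    rw [SimpleGraph.mem_edgeSet]; exact hwv.symm
  have h1 := congrFun h ⟨s(v, w), he⟩
  simp only [cliqueVec, Sym2.mem_iff, forall_eq_or_imp, forall_eq, decide_eq_decide] at h1
  exact (h1.2 ⟨hv, hw⟩).1

/-- **Union bound for the positives**: the `k`-cliques (`k ≥ 2`) meeting a set `q` of edges number
at most `#q · C(m-2, k-2)`. [folklore] -/
theorem card_posMeet_le {m k : ℕ} (hk : 2 ≤ k)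
    (q : Finset ((⊤ : SimpleGraph (Fin m)).edgeSet)) :
    #((posGraphs m k).filter fun x => ∃ e ∈ q, x e = true) ≤ #q * (m - 2).choose (k - 2) := by
  unfold posGraphs
  rw [Finset.filter_image]
  calc #(((powersetCard k (univ : Finset (Fin m))).filter
          fun K => ∃ e ∈ q, cliqueVec K e = true).image cliqueVec)
      ≤ #((powersetCard k (univ : Finset (Fin m))).filter
          fun K => ∃ e ∈ q, cliqueVec K e = true) := Finset.card_image_le
    _ ≤ #(q.biUnion fun e => (powersetCard k (univ : Finset (Fin m))).filter
          fun K => ∀ v ∈ (e : Sym2 (Fin m)), v ∈ K) := by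
        refine Finset.card_le_card fun K hK => ?_
        rw [Finset.mem_filter] at hK
        obtain ⟨hKp, e, heq, he⟩ := hK
        refine Finset.mem_biUnion.2 ⟨e, heq, Finset.mem_filter.2 ⟨hKp, ?_⟩⟩
        simpa [cliqueVec] using he
    _ ≤ ∑ e ∈ q, #((powersetCard k (univ : Finset (Fin m))).filter
          fun K => ∀ v ∈ (e : Sym2 (Fin m)), v ∈ K) := Finset.card_biUnion_le
    _ ≤ ∑ e ∈ q, (m - 2).choose (k - 2) := by
        refine Finset.sum_le_sum fun e _ => ?_
        obtain ⟨z, hz⟩ := e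
        induction z using Sym2.ind with
        | _ x y =>
          have hxy : x ≠ y := (SimpleGraph.mem_edgeSet ⊤).1 hz
          have hX : #({x, y} : Finset (Fin m)) = 2 := Finset.card_pair hxy
          calc #((powersetCard k (univ : Finset (Fin m))).filter fun K => ∀ v ∈ s(x, y), v ∈ K)
              ≤ #((powersetCard k (univ : Finset (Fin m))).filter
                  fun K => ({x, y} : Finset (Fin m)) ⊆ K) :=
                Finset.card_le_card (Finset.monotone_filter_right _ fun K _ hK => by
                  rw [Finset.insert_subset_iff, Finset.singleton_subset_iff]
                  exact ⟨hK x (Sym2.mem_mk_left x y), hK y (Sym2.mem_mk_right x y)⟩)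
            _ ≤ (#(univ : Finset (Fin m)) - #({x, y} : Finset (Fin m))).choose
                  (k - #({x, y} : Finset (Fin m))) :=
                card_filter_supset_powersetCard_le univ {x, y} (by rw [hX]; exact hk)
            _ = (m - 2).choose (k - 2) := by rw [hX, Finset.card_univ, Fintype.card_fin]
    _ = #q * (m - 2).choose (k - 2) := by rw [Finset.sum_const, smul_eq_mul]

/-! ## §2 Numerics -/

/-- Eighth roots: `(m^{1/8})^8 = m` and `(m^{1/8})^2 = m^{1/4}`. [folklore] -/
theorem rpow_eighth_pow (m : ℕ) :
    ((m : ℝ) ^ (1 / 8 : ℝ)) ^ 8 = m ∧ ((m : ℝ) ^ (1 / 8 : ℝ)) ^ 2 = (m : ℝ) ^ (1 / 4 : ℝ) := by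
  constructor
  · rw [← Real.rpow_natCast, ← Real.rpow_mul (Nat.cast_nonneg m)]
    norm_num
  · rw [← Real.rpow_natCast, ← Real.rpow_mul (Nat.cast_nonneg m)]
    norm_num

/-- Integer sandwich for `k = ⌈m^{1/4}⌉₊`: `m ≤ k^4` and `(k-1)^4 < m` (for `m ≥ 1`). [folklore] -/
theorem ceil_sandwich {m : ℕ} (hm : 1 ≤ m) :
    m ≤ ⌈(m : ℝ) ^ (1 / 4 : ℝ)⌉₊ ^ 4 ∧ (⌈(m : ℝ) ^ (1 / 4 : ℝ)⌉₊ - 1) ^ 4 < m := by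
  have hr4 : ((m : ℝ) ^ (1 / 4 : ℝ)) ^ 4 = m := by
    rw [← Real.rpow_natCast, ← Real.rpow_mul (Nat.cast_nonneg m)]
    norm_num
  have hr0 : 0 < (m : ℝ) ^ (1 / 4 : ℝ) := Real.rpow_pos_of_pos (by exact_mod_cast hm) _
  set r := (m : ℝ) ^ (1 / 4 : ℝ) with hr
  have hk1 : r ≤ ⌈r⌉₊ := Nat.le_ceil r
  have hk2 : (⌈r⌉₊ : ℝ) < r + 1 := Nat.ceil_lt_add_one hr0.le
  have hkpos : 1 ≤ ⌈r⌉₊ := Nat.one_le_iff_ne_zero.2 (by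
    intro h0; rw [h0, Nat.cast_zero] at hk1; linarith)
  constructor
  · have h : (m : ℝ) ≤ (⌈r⌉₊ : ℝ) ^ 4 := by
      rw [← hr4]; exact pow_le_pow_left₀ hr0.le hk1 4
    exact_mod_cast h
  · have h1 : ((⌈r⌉₊ - 1 : ℕ) : ℝ) < r := by
      rw [Nat.cast_sub hkpos, Nat.cast_one]; linarith
    have h : ((⌈r⌉₊ - 1 : ℕ) : ℝ) ^ 4 < m := by
      rw [← hr4]; exact pow_lt_pow_left₀ h1 (Nat.cast_nonneg _) four_ne_zero
    exact_mod_cast h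

/-- **Numerics for the positives**: `4 s · C(m-2, k-2) ≤ C(m, k)` once `(k-1)^4 < m` and
`2s + 3 ≤ k` (then `c := m / k ≥ k - 1 ≥ 2s + 2` and `C(m-2,k-2) c² ≤ C(m,k)`). [folklore] -/
theorem pos_numerics {s m k : ℕ} (hkm : (k - 1) ^ 4 < m) (hks : 2 * s + 3 ≤ k) :
    4 * s * (m - 2).choose (k - 2) ≤ m.choose k := by
  have hk0 : 0 < k := by omega
  -- `c := m / k ≥ k - 1`
  have hc : k - 1 ≤ m / k := by
    rw [Nat.le_div_iff_mul_le hk0]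
    refine le_trans ?_ hkm.le
    obtain ⟨j, rfl⟩ : ∃ j, k = j + 1 := ⟨k - 1, by omega⟩
    rw [Nat.add_sub_cancel]
    have hj : 2 ≤ j := by omega
    calc j * (j + 1) ≤ j * (j * j * j) := Nat.mul_le_mul_left j (by nlinarith)
      _ = j ^ 4 := by ring
  have hc1 : 1 ≤ m / k := le_trans (by omega) hc
  have hqc : k * (m / k) ≤ m := Nat.mul_div_le m k
  have key := choose_sub_mul_pow_le hc1 (by omega : 2 ≤ k) hqc
  calc 4 * s * (m - 2).choose (k - 2) ≤ (m / k) ^ 2 * (m - 2).choose (k - 2) := by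
        refine Nat.mul_le_mul_right _ ?_
        calc 4 * s ≤ (2 * s + 2) * (2 * s + 2) := by nlinarith
          _ ≤ (m / k) * (m / k) := Nat.mul_le_mul (by omega) (by omega)
          _ = (m / k) ^ 2 := (sq _).symm
    _ = (m - 2).choose (k - 2) * (m / k) ^ 2 := Nat.mul_comm _ _
    _ ≤ m.choose k := key

/-- **Numerics for the negatives**: with `k = ⌈m^{1/4}⌉₊`, `N = C(m,2)`, `t = N / ⌊m^{1/8}⌋₊`,
eventually `4 · C(m,k) · C(N - C(k,2), t) ≤ C(N, t)` (`(1 - C(k,2)/N)^t ≤ exp(-t C(k,2)/N)` and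
`t C(k,2)/N ≳ m^{3/8}/2 ≫ (m^{1/4} + 1) ln m`). [folklore] -/
theorem neg_numerics : ∀ᶠ m : ℕ in atTop,
    4 * (m.choose ⌈(m : ℝ) ^ (1 / 4 : ℝ)⌉₊ *
      (m.choose 2 - (⌈(m : ℝ) ^ (1 / 4 : ℝ)⌉₊).choose 2).choose
        (m.choose 2 / ⌊(m : ℝ) ^ (1 / 8 : ℝ)⌋₊)) ≤
      (m.choose 2).choose (m.choose 2 / ⌊(m : ℝ) ^ (1 / 8 : ℝ)⌋₊) := by
  have h1 : ∀ᶠ x : ℝ in atTop, ‖Real.log x‖ ≤ (1 / 100) * ‖x ^ (1 / 8 : ℝ)‖ :=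
    (isLittleO_log_rpow_atTop (by norm_num : (0 : ℝ) < 1 / 8)).bound (by norm_num)
  have h2 : ∀ᶠ m : ℕ in atTop, ‖Real.log m‖ ≤ (1 / 100) * ‖(m : ℝ) ^ (1 / 8 : ℝ)‖ :=
    tendsto_natCast_atTop_atTop.eventually h1
  filter_upwards [h2, eventually_ge_atTop 65536] with m hm h65536
  obtain ⟨hu8, hu2⟩ := rpow_eighth_pow m
  have hu0 : 0 < (m : ℝ) ^ (1 / 8 : ℝ) := Real.rpow_pos_of_pos (by positivity) _
  rw [Real.norm_eq_abs, Real.norm_eq_abs, abs_of_nonneg hu0.le,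
    abs_of_nonneg (Real.log_nonneg (by exact_mod_cast (show 1 ≤ m by omega)))] at hm
  rw [← hu2]
  set u := (m : ℝ) ^ (1 / 8 : ℝ) with hu
  set k := ⌈u ^ 2⌉₊ with hk
  set D := ⌊u⌋₊ with hD
  set N := m.choose 2 with hN
  set t := N / D with ht
  set L := k.choose 2 with hL
  -- real-side facts
  have hu4 : (4 : ℝ) ≤ u :=
    le_of_pow_le_pow_left₀ (by norm_num : 8 ≠ 0) hu0.le (by
      rw [hu8]; exact_mod_cast (show 4 ^ 8 ≤ m by norm_num; omega))
  have hk1 : u ^ 2 ≤ k := Nat.le_ceil _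
  have hk2 : (k : ℝ) < u ^ 2 + 1 := Nat.ceil_lt_add_one (by positivity)
  have hD1 : (D : ℝ) ≤ u := Nat.floor_le hu0.le
  have hD0 : 0 < D := Nat.floor_pos.2 (by linarith)
  have hD0r : (0 : ℝ) < D := by exact_mod_cast hD0
  have hlog0 : 0 ≤ Real.log m := Real.log_nonneg (by exact_mod_cast (show 1 ≤ m by omega))
  have hm1 : (1 : ℝ) ≤ m := by exact_mod_cast (show 1 ≤ m by omega)
  -- integer-side facts
  have hm2 : 2 ≤ m := by omega
  have hN0 : 0 < N := Nat.choose_pos hm2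
  have hN0r : (0 : ℝ) < N := by exact_mod_cast hN0
  have hkm : k ≤ m := by
    have h : (k : ℝ) < m + 1 := by
      have : u ^ 2 ≤ u ^ 8 := pow_le_pow_right₀ (by linarith) (by norm_num)
      linarith
    exact_mod_cast Nat.lt_succ_iff.1 (by exact_mod_cast h)
  have hLN : L ≤ N := Nat.choose_le_choose 2 hkm
  have hLNr : (L : ℝ) ≤ N := by exact_mod_cast hLN
  have htD : N < t * D + D := Nat.lt_div_mul_add hD0
  have htDr : (N : ℝ) < t * D + D := by exact_mod_cast htD
  have hLr : (L : ℝ) = k * (k - 1) / 2 := by rw [hL, Nat.cast_choose_two]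
  have hL0 : (0 : ℝ) ≤ L := Nat.cast_nonneg _
  -- the exponent: `log 4 + k log m ≤ t L / N`
  have hA : Real.log 4 + k * Real.log m ≤ t * L / N := by
    have i1 : Real.log 4 ≤ 3 := by
      have := Real.log_le_sub_one_of_pos (by norm_num : (0 : ℝ) < 4); linarith
    have i2 : (k : ℝ) * Real.log m ≤ (u ^ 2 + 1) * (u / 100) :=
      mul_le_mul hk2.le (by linarith) hlog0 (by positivity)
    have i3 : 3 + (u ^ 2 + 1) * (u / 100) ≤ (u ^ 3 - u) / 2 - 1 := by
      nlinarith [mul_le_mul hu4 (mul_le_mul hu4 hu4 (by norm_num) (by linarith))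
        (by norm_num) (by linarith)]
    have i4 : (u ^ 3 - u) / 2 ≤ L / D := by
      rw [le_div_iff₀ hD0r, hLr]
      have hkk : u ^ 2 * (u ^ 2 - 1) ≤ (k : ℝ) * (k - 1) :=
        mul_le_mul hk1 (by linarith) (by nlinarith) (by positivity)
      have : (u ^ 3 - u) / 2 * D ≤ (u ^ 3 - u) / 2 * u :=
        mul_le_mul_of_nonneg_left hD1 (by nlinarith)
      nlinarith
    have i5 : (L : ℝ) / D - 1 ≤ t * L / N := by
      rw [div_sub_one hD0r.ne', div_le_div_iff₀ hD0r hN0r]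
      nlinarith [mul_le_mul_of_nonneg_left htDr.le hL0, mul_le_mul_of_nonneg_right hLNr hD0r.le]
    linarith
  -- the key bound `4 C(m,k) (N - L)^t ≤ N^t`
  have key : 4 * m.choose k * (N - L) ^ t ≤ N ^ t := by
    have hx1 : (L : ℝ) / N ≤ 1 := (div_le_one hN0r).2 hLNr
    have hC : (m.choose k : ℝ) ≤ (m : ℝ) ^ k := by exact_mod_cast Nat.choose_le_pow m k
    have hB : (4 : ℝ) * m.choose k * (1 - L / N) ^ t ≤ 1 := by
      have e1 : (1 - (L : ℝ) / N) ^ t ≤ Real.exp (-(t * (L / N))) := by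
        calc (1 - (L : ℝ) / N) ^ t ≤ (Real.exp (-(L / N))) ^ t :=
              pow_le_pow_left₀ (by linarith) (Real.one_sub_le_exp_neg _) t
          _ = Real.exp (-(t * (L / N))) := by rw [← Real.exp_nat_mul]; ring_nf
      have e2 : (4 : ℝ) * m.choose k ≤ Real.exp (Real.log 4 + k * Real.log m) := by
        rw [Real.exp_add, Real.exp_log (by norm_num), Real.exp_nat_mul, Real.exp_log (by linarith)]
        linarith
      calc (4 : ℝ) * m.choose k * (1 - L / N) ^ t
          ≤ Real.exp (Real.log 4 + k * Real.log m) * Real.exp (-(t * (L / N))) :=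
            mul_le_mul e2 e1 (pow_nonneg (by linarith) t) (Real.exp_nonneg _)
        _ = Real.exp (Real.log 4 + k * Real.log m - t * L / N) := by rw [← Real.exp_add]; ring_nf
        _ ≤ Real.exp 0 := Real.exp_le_exp.2 (by linarith)
        _ = 1 := Real.exp_zero
    have h : (4 : ℝ) * m.choose k * ((N : ℝ) - L) ^ t ≤ (N : ℝ) ^ t := by
      have e : ((N : ℝ) - L) = N * (1 - L / N) := by field_simp
      rw [e, mul_pow]
      calc (4 : ℝ) * m.choose k * ((N : ℝ) ^ t * (1 - L / N) ^ t)
          = (N : ℝ) ^ t * (4 * m.choose k * (1 - L / N) ^ t) := by ring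
        _ ≤ (N : ℝ) ^ t * 1 := mul_le_mul_of_nonneg_left hB (by positivity)
        _ = (N : ℝ) ^ t := mul_one _
    exact_mod_cast (show ((4 * m.choose k * (N - L) ^ t : ℕ) : ℝ) ≤ ((N ^ t : ℕ) : ℝ) by
      push_cast [Nat.cast_sub hLN]; exact h)
  -- combine with `C(N-L, t) N^t ≤ C(N, t) (N-L)^t`
  have hcmp := choose_mul_pow_le_choose_mul_pow (Nat.sub_le N L) t
  refine Nat.le_of_mul_le_mul_right ?_ (Nat.pow_pos hN0 : 0 < N ^ t)
  calc 4 * (m.choose k * (N - L).choose t) * N ^ t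
      = 4 * m.choose k * ((N - L).choose t * N ^ t) := by ring
    _ ≤ 4 * m.choose k * (N.choose t * (N - L) ^ t) := Nat.mul_le_mul_left _ hcmp
    _ = N.choose t * (4 * m.choose k * (N - L) ^ t) := by ring
    _ ≤ N.choose t * N ^ t := Nat.mul_le_mul_left _ key

/-! ## §3 The stub -/

open Classical in
/-- **Referee** (registered stub `stub_referee`): eventually in `m`, at most a quarter of the
negatives (complements of the `t`-edge graphs, `t = #E/⌊m^{1/8}⌋₊`) contain a `⌈m^{1/4}⌉₊`-clique,
and for every set `q` of at most `s` edges at most a quarter of the positives (bare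
`⌈m^{1/4}⌉₊`-cliques) meet `q`. First-moment counting. [folklore] -/
theorem stub_referee : ∀ s : ℕ, ∀ᶠ m : ℕ in atTop,
    4 * #((((powersetCard (Fintype.card ((⊤ : SimpleGraph (Fin m)).edgeSet) / ⌊(m : ℝ) ^ (1 / 8 : ℝ)⌋₊)
          (univ : Finset ((⊤ : SimpleGraph (Fin m)).edgeSet))).image (fun M => fun e => decide (e ∉ M)))).filter
          (fun x => cliqueFn m ⌈(m : ℝ) ^ (1 / 4 : ℝ)⌉₊ x = true)) ≤
      #(((powersetCard (Fintype.card ((⊤ : SimpleGraph (Fin m)).edgeSet) / ⌊(m : ℝ) ^ (1 / 8 : ℝ)⌋₊)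
          (univ : Finset ((⊤ : SimpleGraph (Fin m)).edgeSet))).image (fun M => fun e => decide (e ∉ M)))) ∧
    ∀ q : Finset ((⊤ : SimpleGraph (Fin m)).edgeSet), #q ≤ s →
      4 * #((posGraphs m ⌈(m : ℝ) ^ (1 / 4 : ℝ)⌉₊).filter (fun x => ∃ e ∈ q, x e = true)) ≤
        #(posGraphs m ⌈(m : ℝ) ^ (1 / 4 : ℝ)⌉₊) := by
  intro s
  filter_upwards [neg_numerics, eventually_ge_atTop (max 2 ((2 * s + 3) ^ 4))] with m hneg hm
  have hm2 : 2 ≤ m := le_of_max_le_left hm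
  have hms : (2 * s + 3) ^ 4 ≤ m := le_of_max_le_right hm
  obtain ⟨hmk, hkm⟩ := ceil_sandwich (m := m) (by omega)
  set k := ⌈(m : ℝ) ^ (1 / 4 : ℝ)⌉₊ with hk
  have hks : 2 * s + 3 ≤ k := by
    by_contra hlt
    push Not at hlt
    have h1 : k ^ 4 ≤ (2 * s + 2) ^ 4 := Nat.pow_le_pow_left (by omega) 4
    have h2 : (2 * s + 2) ^ 4 < (2 * s + 3) ^ 4 := Nat.pow_lt_pow_left (by omega) four_ne_zero
    omega
  have hk2 : 2 ≤ k := by omega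
  rw [card_edgeSet_top_fin]
  refine ⟨?_, fun q hq => ?_⟩
  · rw [card_neg_eq, card_edgeSet_top_fin]
    refine le_trans (Nat.mul_le_mul_left 4 ?_) hneg
    have h := card_negClique_le m k (m.choose 2 / ⌊(m : ℝ) ^ (1 / 8 : ℝ)⌋₊)
    rwa [card_edgeSet_top_fin] at h
  · rw [card_posGraphs hk2]
    calc 4 * #((posGraphs m k).filter fun x => ∃ e ∈ q, x e = true)
        ≤ 4 * (#q * (m - 2).choose (k - 2)) := Nat.mul_le_mul_left 4 (card_posMeet_le hk2 q)
      _ ≤ 4 * (s * (m - 2).choose (k - 2)) := Nat.mul_le_mul_left 4 (Nat.mul_le_mul_right _ hq)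
      _ = 4 * s * (m - 2).choose (k - 2) := (Nat.mul_assoc _ _ _).symm
      _ ≤ m.choose k := pos_numerics hkm hks

end Summit.PneNP.PneNP.Theorems.CliqueExtLowerBound.WidthThreshold.Referee
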